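import Summits.HodgeConjecture.CorCM.CMFivefoldsOfMarkman
import Summits.HodgeConjecture.Ring2.NonSimpleFivefoldsCodimTwo
import Literature.AlgebraicGeometry.HodgeTheory.CentreTimesCMCurveNoEmbedding
import Literature.AlgebraicGeometry.Motives.AbelianVarietyIsogenyPairFlip
import HarnessLib

/-!
# Ring 2 (cell topic `Summits/HodgeConjecture/Ring2/`; seat `lit`, gen 64, programme R38 heir H8): MOONEN–ZARHIN Thm. 0.2 IN CODIMENSION 2 — `B²(X) ⊆ D²(X) + Σ_α α^* B²(X')` — FOR EVERY COMPLEX ABELIAN FIVEFOLD OF CM TYPE, UNCONDITIONALLY; the named fact `MoonenZarhin1999_codimTwoHodgeClasses_abelianFivefold` localised to fivefolds NOT of CM type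

HONEST FRAMING (cell `pub-hodge-ring2`, verbatim): research route conditional on HC_CM; not a corollary;
Q11.4-sentence-2 already refuted in dim ≥ 3. `HC_CM` does NOT occur in this file, nor does Markman's theorem: everything
below is UNCONDITIONAL. No case of the Hodge conjecture is claimed: the subject is the STRUCTURE statement
`B² ⊆ D² + Σ_α α^* B²(X')` of Moonen–Zarhin's Thm. 0.2 read in codimension `2` (the Literature predicate
`IsCodimTwoDivisorPullbackGenerated`, lit gen 64), not algebraicity. Summit-side (it needs the cell's CorCM weight
calculus); theorems only — no definition, no named fact, no `sorry`.

THE PRINT. B. Moonen, Yu. Zarhin, Math. Ann. **315** (1999) 711–733, Thm. 0.2 with (2.8), §5 (5.11): for a complex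
abelian fivefold the Hodge classes of `H⁴` lie in `D² + Σ_α α^* B²(X')` (`α` onto abelian fourfolds), the CM case being
read off the Hodge torus weight by weight.  The companion file `Ring2/NonSimpleFivefoldsCodimTwo` (lit gen 64) localised
the tree's NAMED FACT (the codimension-`2` reading for ALL fivefolds) to [simple non-CM (Tankeev–Ribet)] ∧ [case (e)] ∧
[the residual of case (g)], leaving the CM members of (e) and (g) inside.  THIS FILE removes every fivefold of CM type,
by the cell's CorCM eigen-weight calculus (`CorCM/CMProductFivefoldsOfMarkman`, `CMWeightPullbackSubproduct`,
`CMWeilSectionFivefold`) read one step BEFORE algebraicity — where Markman's theorem entered there, nothing enters here: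

* §1 `weightClassesAlg_map_le_span_image` — the weight line `H⁴(B)_{σ_e S''}` of `B = ⨁_i A_i` lies in
  `span (π_e^* s)` whenever `span s` contains the weight line `H⁴(B')_{S''}` of the coordinate sub-product `B'`.
* §2 **`isCodimTwoDivisorPullbackGenerated_biproduct_cm`** — a PAIR-RIGID CM product `B = ⨁_i A_i` of total dimension
  `5` satisfies `B²(B) ⊆ D²(B) + Σ_α α^* B²(X')`, hypothesis-free: a balanced `4`-weight is a divisor monomial or
  `σ_e` of a WEIL SECTION `S''` of the coordinate FOURFOLD `B' = ⨁_{i ≠ i₀} A_i` (`mem_pohlmannDivisorSetsAlg_two_or_weilSection_five`),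
  whose line lies in the Weil plane of the Weil-type pair `(B', φ_{S''})`, the span of its RATIONAL `(2,2)` classes; §1
  with `π_e : B ⟶ B'` the (surjective) projection gives «`Σ_α α^* B²(X')`» on the nose.
* §3 **`isCodimTwoDivisorPullbackGenerated_of_isOfCMType`** — EVERY complex abelian FIVEFOLD OF CM TYPE satisfies
  `B² ⊆ D² + Σ_α α^* B²(X')`, UNCONDITIONALLY (`X ∼` a product of simple CM-typed varieties `≅` a pair-rigid biproduct of
  simple realisations — Shimura's Prop. 26; §2; isogeny invariance).
* §4 **`moonenZarhin1999_codimTwoHodgeClasses_abelianFivefold_iff_residual_not_isOfCMType`** — the named fact ↔ its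
  instances at fivefolds NOT OF CM TYPE: (α) simple non-CM [Tankeev–Ribet], (β) case (e) `X ∼ E × E × T` with `T` NOT
  of CM type, (γ) the residual of case (g) `X ∼ F × C` with the simple fourfold `F` NOT of CM type; granted
  Tankeev–Ribet (hypothesis), ↔ (β) ∧ (γ).  §5 On path.

WHAT IS NOT CLAIMED: the fact is NOT discharged; the non-CM members of case (e) (Thm. 0.2 (1)) and of case (g) with
`End⁰(X₂) ⊋ k` (Thm. 0.2 (3)) and Tankeev–Ribet remain exactly as printed; nothing on algebraicity (for CM fivefolds the
Hodge conjecture granted Markman is the cell's `CorCM/CMFivefoldsOfMarkman`, not used here); nothing on `B² ≠ D²`.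

## References
* [MoonenZarhin1999LowDim] B. Moonen, Yu. Zarhin, Math. Ann. 315 (1999) 711–733, Thm. 0.2 (1)–(4), (2.8), §5 (5.11).
* [Pohlmann1968] H. Pohlmann, Ann. of Math. 88 (1968), Thm. 1.
* [Shimura1998] G. Shimura, *Abelian Varieties with Complex Multiplication and Modular Functions* (1998), §8.2 Prop. 26.
* [MumfordAV1970] D. Mumford, *Abelian Varieties* (1970), §19 Thm. 1, Cor. 1–2 (pp. 173–174) and Remark p. 169.
* [Deligne1982HodgeCycles] P. Deligne, LNM 900 (1982), §4 Prop. 4.4, §5 p. 63.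
* [vanGeemen1994HodgeAV] B. van Geemen, LNM 1594 (1994), 4.9–4.10 and Lemma 5.2.
* [Milne2020HodgeClassesAV] J. S. Milne, *Hodge classes on abelian varieties* (2020), 1.2 (a).
* [Milne1999] J. S. Milne, Compositio Math. 117 (1999), §2 p. 54.
* [SilvermanAEC2009] J. H. Silverman, GTM 106 (2009), III.9 Cor. 9.4.
-/

noncomputable section

open CategoryTheory CategoryTheory.Limits NumberField

namespace Summit.HodgeConjecture.Ring2.CMFivefoldsCodimTwo

open Literature.AlgebraicGeometry.Motives (AbelianVariety CMType IsSmoothProjective ComplexPoints)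
open Literature.AlgebraicGeometry.Motives.AbelianVariety
open Literature.AlgebraicGeometry.HodgeTheory
open Literature.AlgebraicGeometry.Pohlmann1968
open Literature.AlgebraicGeometry.ComplexMultiplication (IsCMTypeRealisation)
open Literature.AlgebraicGeometry.Milne1999 (IsOfCMType surjective_toSchemeHom_of_comp_eq_nsmul_id
  isOfCMType_iff_of_isIsogenous isOfCMType_prod_iff)
open Literature.AlgebraicTopology.SingularHomology
open Literature.NumberTheory.ComplexMultiplication
open Literature.Barriers.HodgeConjecture (divisorClassesSpan)
open Summit.HodgeConjecture.CorCM.Domination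
open Summit.HodgeConjecture.CorCM.CMWeights
open Summit.HodgeConjecture.Ring2.NonSimpleFivefoldsCodimTwo

open scoped Classical Pointwise

section Biproduct

variable {m n : ℕ} {K : Fin n → Type} [∀ i, Field (K i)] [∀ i, NumberField (K i)] [∀ i, IsCMField (K i)]
variable {A : Fin n → AbelianVariety ℂ} {Φ : ∀ i, CMType (K i)} {ι : ∀ i, 𝓞 (K i) →+* End (A i)}
  {θ : ∀ i, K i →+* Module.End ℂ (complexBetti (A i).X 1)}

/-! ### §1 A weight line pulls back inside the pull-back of any span containing the small weight line -/

omit [∀ i, IsCMField (K i)] in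
/-- **Weight lines descend from a coordinate sub-product inside pull-backs**: if the weight line `H^k(B')_{S''}` of
`B' = ⨁_j A_{e j}` (`#S'' = k`) lies in `span_ℂ s`, the weight line `H^k(B)_{σ_e S''}` of `B = ⨁_i A_i` lies in
`span_ℂ (π_e^* s)` (it is the line of the non-zero pull-back `π_e^* c''` of a generator; the cell's
`weightClassesAlg_map_le_algebraicClasses` with `Nᵖ` replaced by a span). [cite: MoonenZarhin1999LowDim, Thm. 0.2 and (2.8)]
[cite: Milne2020HodgeClassesAV, 1.2 (a)] [cite: MumfordAV1970, §19] -/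
theorem weightClassesAlg_map_le_span_image (hA : ∀ i, IsCMTypeRealisation (Φ i) (A i) (ι i) (θ i))
    (e : Fin m → Fin n) (he : Function.Injective e) {k : ℕ} {S'' : Finset ((j : Fin m) × (K (e j) →+* ℂ))}
    (hS'' : S''.card = k) {s : Set (complexBetti (⨁ (fun j => A (e j))).X k)}
    (hle : weightClassesAlg (fun j => A (e j)) (fun j => ι (e j)) k S'' ≤ Submodule.span ℂ s) :
    weightClassesAlg A ι k (S''.map ⟨_, sigma_map_injective e he⟩) ≤
      Submodule.span ℂ ((fun c => complexBetti.map (biproduct.lift (fun j => biproduct.π A (e j)) :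
        (⨁ A) ⟶ ⨁ (fun j => A (e j))).hom.hom.hom k c) '' s) := by
  -- a non-zero generator of the small line and its (non-zero) pull-back
  obtain ⟨c'', hc''0, hline''⟩ :=
    exists_weightClassesAlg_eq_span_singleton (A := fun j => A (e j)) (Φ := fun j => Φ (e j))
      (ι := fun j => ι (e j)) (θ := fun j => θ (e j)) (fun j => hA (e j)) hS''
  set π : (⨁ A) ⟶ ⨁ (fun j => A (e j)) := biproduct.lift (fun j => biproduct.π A (e j)) with hπ
  have hc''mem : c'' ∈ weightClassesAlg (fun j => A (e j)) (fun j => ι (e j)) k S'' := by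
    rw [hline'']; exact Submodule.mem_span_singleton_self _
  have hpc_mem : complexBetti.map π.hom.hom.hom k c'' ∈ weightClassesAlg A ι k (S''.map ⟨_, sigma_map_injective e he⟩) :=
    map_mem_weightClassesAlg_of_mem e he hc''mem
  have hpc_ne : complexBetti.map π.hom.hom.hom k c'' ≠ 0 := fun h =>
    hc''0 (complexBetti_map_lift_π_injective e he k (by rw [h, map_zero]))
  have hpc_in : complexBetti.map π.hom.hom.hom k c'' ∈
      Submodule.span ℂ ((fun c => complexBetti.map π.hom.hom.hom k c) '' s) := by
    have h := Submodule.mem_map_of_mem (f := (complexBetti.map π.hom.hom.hom k).hom) (hle hc''mem)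
    rw [Submodule.map_span] at h
    exact h
  -- the big line is spanned by the pull-back
  have hScard : (S''.map ⟨_, sigma_map_injective e he⟩).card = k := by rw [Finset.card_map, hS'']
  obtain ⟨c, hc0, hline⟩ := exists_weightClassesAlg_eq_span_singleton hA hScard
  rw [hline] at hpc_mem ⊢
  obtain ⟨t, ht⟩ := Submodule.mem_span_singleton.1 hpc_mem
  have ht0 : t ≠ 0 := by rintro rfl; rw [zero_smul] at ht; exact hpc_ne ht.symm
  rw [Submodule.span_singleton_le_iff_mem]
  have hc_eq : c = t⁻¹ • complexBetti.map π.hom.hom.hom k c'' := by rw [← ht, smul_smul, inv_mul_cancel₀ ht0, one_smul]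
  rw [hc_eq]; exact Submodule.smul_mem _ _ hpc_in

/-! ### §2 Pair-rigid CM products of total dimension `5`: `B² ⊆ D² + Σ_α α^* B²(X')`, hypothesis-free -/

/-- **`B²(B) ⊗ ℂ ⊆ (D²(B) ⊗ ℂ) + span_ℂ {π^* w : π : B ↠ B' an abelian FOURFOLD, w a rational (2,2)-class}` for a
PAIR-RIGID CM-product fivefold `B = ⨁_i A_i`** — the CONCLUSION of `MoonenZarhin1999_codimTwoHodgeClasses_abelianFivefold`
at `B`, PROVED: by Pohlmann (`mem_iSup_weightClassesAlg`) and the fivefold dichotomy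
(`mem_pohlmannDivisorSetsAlg_two_or_weilSection_five`) a balanced `4`-weight `S` is a divisor monomial (line in `D² ⊗ ℂ`,
`divisorClassesSpan_biproduct_eq_iSup`) or `S = σ_e S''`, `S''` a WEIL SECTION of the coordinate FOURFOLD
`B' = ⨁_{i ≠ i₀} A_i` (`[K_{i₀}:ℚ] = 2`); then `(B', φ_{S''})` is of Weil type, its Weil plane contains the line of `S''`
(`isWeilType_of_weilSection`) and is the span of its RATIONAL classes, all of type `(2,2)`, so by §1 the line of `S` lies
in `span {π_e^* w}`, `π_e : B ⟶ B'` the projection (surjective: section `⊕_j ι_{e j}`).  The block `S = σ_e S''` is the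
cell's `weightClassesAlg_le_algebraicClasses_two_five_of_markman`, verbatim; Markman's theorem does not enter.
[cite: MoonenZarhin1999LowDim, Thm. 0.2 with (2.8) and §5 (5.11)] [cite: Pohlmann1968, Thm. 1]
[cite: Deligne1982HodgeCycles, §4 Prop. 4.4] [cite: vanGeemen1994HodgeAV, 4.9–4.10 and Lemma 5.2] -/
theorem isCodimTwoDivisorPullbackGenerated_biproduct_cm (hA : ∀ i, IsCMTypeRealisation (Φ i) (A i) (ι i) (θ i))
    (h5 : (⨁ A).dim = 5)
    (hrig : ∀ x y : (i : Fin n) × (K i →+* ℂ), x.1 = y.1 → x ≠ y →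
      IsGaloisBalancedAlg Φ ({x} ∪ ({y} : Finset _)) → y = (starRingAut : ℂ ≃+* ℂ) • x) :
    IsCodimTwoDivisorPullbackGenerated (⨁ A) := by
  intro c hcQ hcH
  have h10 : ∑ i, Module.finrank ℚ (K i) = 10 := by rw [sum_finrank_eq_two_mul_dim hA, h5]
  refine (iSup₂_le fun S hS => ?_ :
    (⨆ S ∈ pohlmannSetsAlg Φ 2, weightClassesAlg A ι (2 * 2) S) ≤ _) (mem_iSup_weightClassesAlg hA hcQ hcH)
  rcases mem_pohlmannDivisorSetsAlg_two_or_weilSection_five h10 Φ hrig hS with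
    hD | ⟨hsec, x₀, hx₀, hx₀', hcov, hτ⟩
  · -- a divisor monomial: its line lies in `D² ⊗ ℂ`
    refine le_trans ?_ le_sup_left
    rw [divisorClassesSpan_biproduct_eq_iSup hA 2]
    exact le_iSup₂_of_le S hD le_rfl
  -- the block `i₀ = x₀.1` is `{x₀, ρ x₀}`: an imaginary quadratic field
  have hblock : ∀ s : K x₀.1 →+* ℂ, (⟨x₀.1, s⟩ : (i : Fin n) × (K i →+* ℂ)) = x₀ ∨
      (⟨x₀.1, s⟩ : (i : Fin n) × (K i →+* ℂ)) = (starRingAut : ℂ ≃+* ℂ) • x₀ := by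
    intro s
    haveI : Countable (K x₀.1) := countable_field x₀.1
    obtain ⟨τ, hτs⟩ := Literature.AlgebraicGeometry.Motives.ZarhinLie.exists_ringEquiv_complex_comp_eq x₀.2 s
    have hτx : τ • x₀ = ⟨x₀.1, s⟩ := by
      rw [smul_sigma_eq]
      exact congrArg (Sigma.mk x₀.1) (RingHom.ext fun b => hτs b)
    rw [← hτx]
    exact (hτ τ).1
  have hnot_block : ∀ x ∈ S, x.1 ≠ x₀.1 := by
    intro x hx h
    obtain ⟨i, s⟩ := x
    change i = x₀.1 at h
    subst h
    rcases hblock s with h' | h'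
    · exact hx₀ (h' ▸ hx)
    · exact hx₀' (h' ▸ hx)
  have hK₀ : Module.finrank ℚ (K x₀.1) = 2 := by
    rw [← Embeddings.card (K x₀.1) ℂ]
    have hne : ComplexEmbedding.conjugate x₀.2 ≠ x₀.2 := by
      intro h
      apply conj_smul_ne_self Φ x₀
      rw [conj_smul_sigma_eq]
      exact congrArg (Sigma.mk x₀.1) h
    apply le_antisymm
    · -- every embedding is `x₀.2` or its conjugate
      have hsub : (Finset.univ : Finset (K x₀.1 →+* ℂ)) ⊆ {x₀.2, ComplexEmbedding.conjugate x₀.2} := by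
        intro s _
        rw [Finset.mem_insert, Finset.mem_singleton]
        rcases hblock s with h | h
        · exact Or.inl (eq_of_heq (Sigma.mk.inj_iff.1 h).2)
        · right
          rw [conj_smul_sigma_eq] at h
          exact eq_of_heq (Sigma.mk.inj_iff.1 h).2
      calc Fintype.card (K x₀.1 →+* ℂ) = (Finset.univ : Finset (K x₀.1 →+* ℂ)).card := Finset.card_univ.symm
        _ ≤ ({x₀.2, ComplexEmbedding.conjugate x₀.2} : Finset _).card := Finset.card_le_card hsub
        _ ≤ 2 := Finset.card_le_two
    · calc 2 = ({x₀.2, ComplexEmbedding.conjugate x₀.2} : Finset _).card := by rw [Finset.card_pair hne.symm]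
        _ ≤ Fintype.card (K x₀.1 →+* ℂ) := Finset.card_le_univ _
  -- re-index the other blocks by `Fin n'`, `n = n' + 1`
  obtain ⟨n', rfl⟩ : ∃ n', n = n' + 1 := ⟨n - 1, by have := x₀.1.pos; omega⟩
  set e : Fin n' → Fin (n' + 1) := x₀.1.succAbove with he_def
  have he : Function.Injective e := Fin.succAbove_right_injective
  have he₀ : ∀ j, e j ≠ x₀.1 := fun j => Fin.succAbove_ne x₀.1 j
  set emb : ((j : Fin n') × (K (e j) →+* ℂ)) ↪ ((i : Fin (n' + 1)) × (K i →+* ℂ)) :=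
    ⟨_, sigma_map_injective e he⟩ with hemb
  -- `S = σ_e(S'')`
  set S'' : Finset ((j : Fin n') × (K (e j) →+* ℂ)) := S.preimage emb emb.injective.injOn with hS''
  have hSmap : S''.map emb = S := by
    ext x
    simp only [Finset.mem_map, hS'', Finset.mem_preimage]
    constructor
    · rintro ⟨y, hy, rfl⟩; exact hy
    · intro hx
      obtain ⟨j, hj⟩ := Fin.exists_succAbove_eq (hnot_block x hx)
      obtain ⟨i, s⟩ := x
      change x₀.1.succAbove j = i at hj
      subst hj
      exact ⟨⟨j, s⟩, hx, rfl⟩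
  have hS''card : S''.card = 2 * 2 := by rw [← Finset.card_map emb, hSmap]; exact hS.1
  -- the sub-family: total dimension `4`
  have hA'' : ∀ j, IsCMTypeRealisation (Φ (e j)) (A (e j)) (ι (e j)) (θ (e j)) := fun j => hA (e j)
  have h8 : ∑ j, Module.finrank ℚ (K (e j)) = 8 := by
    have hsum := Fin.sum_univ_succAbove (fun i => Module.finrank ℚ (K i)) x₀.1
    rw [h10, hK₀] at hsum
    change 10 = 2 + ∑ j, Module.finrank ℚ (K (e j)) at hsum
    omega
  have hdim'' : (⨁ fun j => A (e j)).dim = 2 * 2 := by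
    have h := sum_finrank_eq_two_mul_dim (A := fun j => A (e j)) (Φ := fun j => Φ (e j)) (ι := fun j => ι (e j))
      (θ := fun j => θ (e j)) hA''
    omega
  -- `S''` is a Weil section of the sub-family
  have hS''mem : S'' ∈ pohlmannSetsAlg (fun j => Φ (e j)) 2 :=
    ⟨hS''card, isGaloisBalancedAlg_comap e he Φ (hSmap.symm ▸ hS.2)⟩
  have hmem_iff : ∀ y : (j : Fin n') × (K (e j) →+* ℂ), y ∈ S'' ↔ emb y ∈ S := fun y => by
    rw [← hSmap, Finset.mem_map' emb]
  have hemb_conj : ∀ y : (j : Fin n') × (K (e j) →+* ℂ),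
      emb ((starRingAut : ℂ ≃+* ℂ) • y) = (starRingAut : ℂ ≃+* ℂ) • emb y := fun _ => rfl
  have hsec'' : ∀ y ∈ S'', (starRingAut : ℂ ≃+* ℂ) • y ∉ S'' := by
    intro y hy hy'
    rw [hmem_iff] at hy hy'; rw [hemb_conj] at hy'
    exact hsec _ hy hy'
  have hfull'' : ∀ y : (j : Fin n') × (K (e j) →+* ℂ), y ∈ S'' ∨ (starRingAut : ℂ ≃+* ℂ) • y ∈ S'' := by
    intro y
    rw [hmem_iff, hmem_iff, hemb_conj]
    rcases hcov (emb y) with h | h | h | h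
    · exact Or.inl h
    · exact Or.inr h
    · exact absurd (congrArg Sigma.fst h) (he₀ y.1)
    · have h' := congrArg Sigma.fst h
      rw [conj_smul_sigma_eq] at h'
      exact absurd h' (he₀ y.1)
  have hW'' : ∀ τ : ℂ ≃+* ℂ, τ • S'' = S'' ∨ τ • S'' = (starRingAut : ℂ ≃+* ℂ) • S'' := by
    intro τ
    rcases (hτ τ).2 with h | h
    · left
      apply Finset.map_injective emb
      rw [← smul_finset_map_sigma e he τ S'', hSmap, h]
    · right
      apply Finset.map_injective emb
      rw [← smul_finset_map_sigma e he τ S'', ← smul_finset_map_sigma e he _ S'', hSmap, h]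
  -- `(B', φ_{S''})` is a pair of Weil type; its Weil plane contains the line of `S''` and is spanned by its rational
  -- classes, all of Hodge type `(2,2)`
  obtain ⟨d, a, hd, hφ, hle, hWT⟩ := isWeilType_of_weilSection hA'' (by norm_num) hdim'' hS''mem hsec'' hfull'' hW''
  rw [weilClassesOf_eq_span_isRationalClass (by norm_num) hdim'' hd hφ] at hle
  -- the projection `π_e : B ⟶ B'` is surjective (it has the section `⊕_j ι_{e j}`)
  have hπs : _root_.AlgebraicGeometry.Surjective (AbelianVariety.Hom.toSchemeHom
      (biproduct.lift (fun j => biproduct.π A (e j)) : (⨁ A) ⟶ ⨁ (fun j => A (e j)))) :=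
    surjective_toSchemeHom_of_comp_eq_nsmul_id (biproduct.desc (fun j => biproduct.ι A (e j))) _ one_ne_zero
      (by rw [biproduct_desc_ι_comp_lift_π e he, one_smul])
  -- the line of `S = σ_e S''` lies in the span of the pull-backs of the rational Weil classes of `B'`
  have h := weightClassesAlg_map_le_span_image hA e he hS''card hle
  rw [hSmap] at h
  refine h.trans (le_trans (Submodule.span_mono ?_) le_sup_right)
  rintro _ ⟨w, ⟨hwQ, hwW⟩, rfl⟩
  refine ⟨⨁ (fun j => A (e j)), biproduct.lift (fun j => biproduct.π A (e j)), w, by omega, hπs, hwQ, ?_, rfl⟩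
  rw [hdim'']
  exact hWT.isOfHodgeType_of_mem_weilClassesOf hwW

end Biproduct

/-! ### §3 Every complex abelian fivefold of CM type -/

variable {X : AbelianVariety ℂ}

/-- **MOONEN–ZARHIN Thm. 0.2 IN CODIMENSION 2 FOR EVERY COMPLEX ABELIAN FIVEFOLD OF CM TYPE — UNCONDITIONAL:
`B²(X) ⊆ D²(X) + Σ_α α^* B²(X')`** (simple or not; in particular the CM members `E × E × T` of case (e) and `F × C` of
case (g)).  `X ∼ B`, a product of SIMPLE CM-typed varieties (`exists_isProductOf_simple_cmTyped`), dominated by — being of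
the same dimension, isogenous to — a biproduct of simple realisations (`exists_simple_biproduct_family_of_isProductOf`),
pair-rigid by Shimura's Prop. 26 (`eq_conj_smul_of_isGaloisBalancedAlg_pair_of_isSimple`); §2 and isogeny invariance.
[cite: MoonenZarhin1999LowDim, Thm. 0.2 with (2.8) and §5 (5.11)] [cite: Pohlmann1968, Thm. 1]
[cite: Shimura1998, §8.2 Prop. 26 (p. 63), §5.1 Props. 3–6 and §7.1] [cite: MumfordAV1970, §19 Thm. 1 and Remark p. 169] -/
theorem isCodimTwoDivisorPullbackGenerated_of_isOfCMType (hX5 : X.dim = 5) (hcm : IsOfCMType X) :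
    IsCodimTwoDivisorPullbackGenerated X := by
  obtain ⟨B, hB, hXB⟩ := exists_isProductOf_simple_cmTyped X (by omega) hcm
  obtain ⟨n, K, iF, iN, iC, C, Φ, ι, θ, hC, hsC, hdom, hdim⟩ := exists_simple_biproduct_family_of_isProductOf hB
  have hBdim : B.dim = 5 := by obtain ⟨g, hg⟩ := hXB; rw [← dim_eq_of_isIsogeny hg, hX5]
  have hCdim : (⨁ C).dim = 5 := hdim.trans hBdim
  have hP : IsCodimTwoDivisorPullbackGenerated (⨁ C) :=
    isCodimTwoDivisorPullbackGenerated_biproduct_cm hC hCdim (eq_conj_smul_of_isGaloisBalancedAlg_pair_of_isSimple hC hsC)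
  obtain ⟨s, π, N, hN, hsπ⟩ := hdom
  have hs : AbelianVariety.IsIsogeny s :=
    isIsogeny_of_comp_eq_nsmul_id (K := ℂ) (Nat.cast_ne_zero.2 hN) hsπ (hBdim.trans hCdim.symm)
  exact (hP.of_isIsogeny hs).of_isIsogenous hXB

/-! ### §4 The named fact localised to fivefolds not of CM type -/

/-- In case (e), if `X ∼ E × (E × T)` is NOT of CM type then `T` is not (`E` is; CM type is stable under products and
isogeny). [cite: Deligne1982HodgeCycles, §5 p. 63] [cite: Milne1999, §2 p. 54] -/
theorem not_isOfCMType_of_caseE {E T : AbelianVariety ℂ} (hX : ¬ IsOfCMType X) (hE : IsOfCMType E)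
    (hXE : AbelianVariety.IsIsogenous X (E.prod (E.prod T))) : ¬ IsOfCMType T := fun hT =>
  hX ((isOfCMType_iff_of_isIsogenous hXE).2 (isOfCMType_prod_iff.2 ⟨hE, isOfCMType_prod_iff.2 ⟨hE, hT⟩⟩))

/-- In case (g), if `X ∼ F × C` is NOT of CM type and the elliptic curve `C` carries `χ ≫ χ = -d'` (`d' > 0`), then
`F` is not of CM type (`C` is, Silverman III.9). [cite: SilvermanAEC2009, III.9 Cor. 9.4] [cite: Milne1999, §2 p. 54] -/
theorem not_isOfCMType_of_caseG {F C : AbelianVariety ℂ} (hX : ¬ IsOfCMType X) (hC : C.dim = 1) {χ : C ⟶ C}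
    {d' : ℕ} (hd' : 0 < d') (hχ : χ ≫ χ = -(d' • 𝟙 C)) (hXF : AbelianVariety.IsIsogenous X (F.prod C)) :
    ¬ IsOfCMType F := fun hF =>
  hX ((isOfCMType_iff_of_isIsogenous hXF).2
    (isOfCMType_prod_iff.2 ⟨hF, isOfCMType_of_hom_comp_self_eq_neg hC hd' hχ⟩))

/-- **LOCALISATION OF THE NAMED FACT, REFINED.** `MoonenZarhin1999_codimTwoHodgeClasses_abelianFivefold` is
EQUIVALENT to its instances at fivefolds NOT OF CM TYPE in the three residual classes: (α) SIMPLE non-CM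
[Tankeev–Ribet]; (β) case (e) `X ∼ E × (E × T)` with the simple threefold `T` NOT of CM type [Thm. 0.2 (1)]; (γ) the
residual of case (g) `X ∼ F × C` with the simple fourfold `F` NOT of CM type (`C` a CM curve `χ ≫ χ = -d'`, a central
unbalanced `φ` on `F` with `φ ≫ φ = -(M²d')`, `dim_ℚ End⁰(F) ≠ 2`) [Thm. 0.2 (3), `End⁰(X₂) ⊋ k`]; CM fivefolds: §3;
the rest: the companion census. [cite: MoonenZarhin1999LowDim, Thm. 0.2 (1)–(4) and §5 (5.1), (5.11)] [cite: Pohlmann1968, Thm. 1] -/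
theorem moonenZarhin1999_codimTwoHodgeClasses_abelianFivefold_iff_residual_not_isOfCMType :
    MoonenZarhin1999_codimTwoHodgeClasses_abelianFivefold ↔
      (∀ A : AbelianVariety ℂ, A.dim = 5 → A.IsSimple → ¬ IsOfCMType A → IsCodimTwoDivisorPullbackGenerated A) ∧
      (∀ A : AbelianVariety ℂ, A.dim = 5 →
        (∃ E T : AbelianVariety ℂ, E.dim = 1 ∧ IsOfCMType E ∧ T.IsSimple ∧ T.dim = 3 ∧ ¬ IsOfCMType T ∧
          Nonempty (E.endAlgebra →+* T.endAlgebra) ∧ AbelianVariety.IsIsogenous A (E.prod (E.prod T))) →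
        IsCodimTwoDivisorPullbackGenerated A) ∧
      (∀ A : AbelianVariety ℂ, A.dim = 5 →
        (∃ (F C : AbelianVariety ℂ), F.IsSimple ∧ F.dim = 4 ∧ ¬ IsOfCMType F ∧ C.dim = 1 ∧
          AbelianVariety.IsIsogenous A (F.prod C) ∧
          ∃ (χ : C ⟶ C) (d' : ℕ), 0 < d' ∧ χ ≫ χ = -(d' • 𝟙 C) ∧ ∃ (φ : F ⟶ F) (M : ℕ), 0 < M ∧
          φ ≫ φ = -((M * M * d') • 𝟙 F) ∧ AbelianVariety.endAlgebra.of F φ ∈ Subalgebra.center ℚ F.endAlgebra ∧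
          eigenMultiplicity F φ (Complex.I * (Real.sqrt (M * M * d' : ℕ) : ℂ)) ≠
            eigenMultiplicity F φ (-(Complex.I * (Real.sqrt (M * M * d' : ℕ) : ℂ))) ∧
          Module.finrank ℚ F.endAlgebra ≠ 2) →
        IsCodimTwoDivisorPullbackGenerated A) := by
  refine ⟨fun h => ⟨fun A hA _ _ => h A hA, fun A hA _ => h A hA, fun A hA _ => h A hA⟩, fun ⟨hS, hE, hG⟩ A hA => ?_⟩
  by_cases hcm : IsOfCMType A
  · exact isCodimTwoDivisorPullbackGenerated_of_isOfCMType hA hcm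
  by_cases hs : A.IsSimple
  · exact hS A hA hs hcm
  by_cases hcaseE : ∃ E T : AbelianVariety ℂ, E.dim = 1 ∧ IsOfCMType E ∧ T.IsSimple ∧ T.dim = 3 ∧
      Nonempty (E.endAlgebra →+* T.endAlgebra) ∧ AbelianVariety.IsIsogenous A (E.prod (E.prod T))
  · obtain ⟨E, T, hE1, hEcm, hTs, hT3, hj, hAET⟩ := hcaseE
    exact hE A hA ⟨E, T, hE1, hEcm, hTs, hT3, not_isOfCMType_of_caseE hcm hEcm hAET, hj, hAET⟩
  by_cases hcaseG : ∃ (F C : AbelianVariety ℂ), F.IsSimple ∧ F.dim = 4 ∧ ¬ IsOfCMType F ∧ C.dim = 1 ∧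
      AbelianVariety.IsIsogenous A (F.prod C) ∧
      ∃ (χ : C ⟶ C) (d' : ℕ), 0 < d' ∧ χ ≫ χ = -(d' • 𝟙 C) ∧ ∃ (φ : F ⟶ F) (M : ℕ), 0 < M ∧
      φ ≫ φ = -((M * M * d') • 𝟙 F) ∧ AbelianVariety.endAlgebra.of F φ ∈ Subalgebra.center ℚ F.endAlgebra ∧
      eigenMultiplicity F φ (Complex.I * (Real.sqrt (M * M * d' : ℕ) : ℂ)) ≠
        eigenMultiplicity F φ (-(Complex.I * (Real.sqrt (M * M * d' : ℕ) : ℂ))) ∧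
      Module.finrank ℚ F.endAlgebra ≠ 2
  · exact hG A hA hcaseG
  refine isCodimTwoDivisorPullbackGenerated_of_dim_eq_five_of_not_isSimple hA hs ?_ hcaseE
  intro F C hFs hF4 hC hAFC χ d' hd' hχ φ M hM hφ hφZ hneq
  by_contra h2
  exact hcaseG ⟨F, C, hFs, hF4, not_isOfCMType_of_caseG hcm hC hd' hχ hAFC, hC, hAFC, χ, d', hd', hχ, φ, M, hM, hφ,
    hφZ, hneq, h2⟩

/-- **GRANTED THE TANKEEV–RIBET FACT** (the tree's named fact
`TankeevRibet1983_hodgeClasses_divisorial_powers_simplePrimeDimension`, a HYPOTHESIS: simple fivefolds have `B = D`),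
the fivefold fact is EQUIVALENT to its instances at the NON-CM members of case (e) (`T` not of CM type) and of the
residual of case (g) (`F` not of CM type). [cite: MoonenZarhin1999LowDim, Thm. 0.2 (1), (3) and §2 Thm. (2.7)]
[cite: Ribet1983, Thm. 3] -/
theorem moonenZarhin1999_codimTwoHodgeClasses_abelianFivefold_iff_residual_not_isOfCMType_of_tankeevRibet
    (hTR : TankeevRibet1983_hodgeClasses_divisorial_powers_simplePrimeDimension) :
    MoonenZarhin1999_codimTwoHodgeClasses_abelianFivefold ↔
      (∀ A : AbelianVariety ℂ, A.dim = 5 →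
        (∃ E T : AbelianVariety ℂ, E.dim = 1 ∧ IsOfCMType E ∧ T.IsSimple ∧ T.dim = 3 ∧ ¬ IsOfCMType T ∧
          Nonempty (E.endAlgebra →+* T.endAlgebra) ∧ AbelianVariety.IsIsogenous A (E.prod (E.prod T))) →
        IsCodimTwoDivisorPullbackGenerated A) ∧
      (∀ A : AbelianVariety ℂ, A.dim = 5 →
        (∃ (F C : AbelianVariety ℂ), F.IsSimple ∧ F.dim = 4 ∧ ¬ IsOfCMType F ∧ C.dim = 1 ∧
          AbelianVariety.IsIsogenous A (F.prod C) ∧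
          ∃ (χ : C ⟶ C) (d' : ℕ), 0 < d' ∧ χ ≫ χ = -(d' • 𝟙 C) ∧ ∃ (φ : F ⟶ F) (M : ℕ), 0 < M ∧
          φ ≫ φ = -((M * M * d') • 𝟙 F) ∧ AbelianVariety.endAlgebra.of F φ ∈ Subalgebra.center ℚ F.endAlgebra ∧
          eigenMultiplicity F φ (Complex.I * (Real.sqrt (M * M * d' : ℕ) : ℂ)) ≠
            eigenMultiplicity F φ (-(Complex.I * (Real.sqrt (M * M * d' : ℕ) : ℂ))) ∧
          Module.finrank ℚ F.endAlgebra ≠ 2) →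
        IsCodimTwoDivisorPullbackGenerated A) := by
  rw [moonenZarhin1999_codimTwoHodgeClasses_abelianFivefold_iff_residual_not_isOfCMType]
  refine ⟨fun h => ⟨h.2.1, h.2.2⟩, fun h => ⟨fun A hA hs _ => ?_, h.1, h.2⟩⟩
  exact (isDivisorGenerated_powSucc_of_tankeevRibet hTR A (by norm_num : (5 : ℕ).Prime) hA hs 0)
    |>.isCodimTwoDivisorPullbackGenerated

/-- **On path** (§5): the named fact, granted, gives the instance proved in §3 (a CASE of the fact; no new target is
introduced). [cite: MoonenZarhin1999LowDim, Thm. 0.2] -/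
theorem isCodimTwoDivisorPullbackGenerated_of_isOfCMType_of_fact
    (h : MoonenZarhin1999_codimTwoHodgeClasses_abelianFivefold) (hX5 : X.dim = 5) (_hcm : IsOfCMType X) :
    IsCodimTwoDivisorPullbackGenerated X :=
  isCodimTwoDivisorPullbackGenerated_of_dim_eq_five_of_fact h hX5

end Summit.HodgeConjecture.Ring2.CMFivefoldsCodimTwo

end
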